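import Literature.Probability.RandomPlanarGeometry.HexSAWStripWidthTwoContactVariance
import HarnessLib

/-!
# The width-two strip at criticality: CHERNOFF BOUNDS for the surface contacts via the explicit Perron parametrisation of the tilted transfer
# matrix — the contact density of a long critical bridge concentrates EXPONENTIALLY at `θ₂ = (3 − √2)/4` (module «WIDTH-TWO CONTACT CHERNOFF BOUNDS»)

Topic `Literature/Probability/RandomPlanarGeometry` (continues «WIDTH-TWO CONTACT VARIANCE RATE» / «… CHEBYSHEV RATE» — `W2.limTwo_pos`, the
vocabulary `hatD 2 y k a b = Σ_{bridges} wD 2 y l` — and «WIDTH-TWO HAT RECURSION / CONVERGENCE» — `W2.gTwo`, `W2.hatD_two_eq_pow_mul`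
(`D̂(k; y) = G(y)^k·(1 + M̂(0))` for EVERY `y ≥ 0`), `W2.tendsto_hatD_two`, `xc_minpoly`, `seven_mul_stripYT_two`).
Lane «pcv-sawmu» (CriticalPhenomena venture), a-p2 g27.  Setting: the exponential tilt `y ↦ y·e^t` of the contact fugacity multiplies the weight
of a bridge by `e^{t·#top}`, so `D̂(k; y)/D̂(k; y₂)` is the moment generating function of `#top`; its growth is governed by the Perron root `λ(y)` of
`G(y)` (E. Seneta, *Non-negative matrices* (1973) §1.1, §1.4; W. Feller I (1968) XIII.6; H. Duminil-Copin, A. Hammond, CMP 324 (2013) §2.2 for the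
weights).  The new device is to parametrise the tilt by the Perron root itself: the Perron cubic `c(y, λ) = λ³ − x²(1+y)λ² + x⁴yλ − x⁶y` is LINEAR in `y`,
so `y(λ) = λ²(λ − x²)/(x²(λ² − x²λ + x⁴))` and the positive eigenvector are explicit rational functions — no Cardano formula, no implicit function.
Nothing below is printed.

## What is proved (namespace `…SAW.HV.W2`, `x = x_c`, `y₂ = stripYT 2`, `n_k = hatLen k a b`)

§1 `perronCubicTwo`, ★ `yOfLam` with `perronCubicTwo_yOfLam` (`c(y(λ), λ) = 0`), `yOfLam_pos` (`λ > x²`), ★ `yOfLam_one` (`y(1) = y₂`),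
`monoPoly_pos`, ★ `yOfLam_sub_stripYT_two` (`y(λ) − y₂ = (λ − 1)·Q(λ)/(positive)`), `yOfLam_facts` (`y(λ) ≷ y₂ ⟺ λ ≷ 1` on `λ > x²`).
§2 ★ `uLam y λ = (x³y, x⁴y, xy(λ − x²), λ(λ − x²))`, `gTwo_mulVec_uLam` (`G(y)u = λu` when `c(y,λ) = 0`), `uLam_pos`, `gTwo_pow_mulVec_uLam`,
`gTwo_pow_apply_nonneg`, ★ `gTwo_pow_apply_mul_uLam_le` (`(G^k)_{ac}u_c ≤ λ^k u_a`).
§3 `tiltConstTwo`, ★ `hatD_two_le_tilt` (`D̂(k; y)_{ab} ≤ T_{ab}(y,λ)·λ^k`, `k ≥ 1`).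
§4 ★ `sum_filter_ge_wD_le_tilt` / `sum_filter_le_wD_le_tilt` (exponential tilting of the finite weight sums), `hatD_two_eq_sum_wD`.
§5 ★★★ `widthTwo_contacts_upper_chernoff` — for `λ > 1`: `∃ C, ∀ᶠ k, ∀ m, P_k^{ab}(#top ≥ m) ≤ C·λ^k·(y₂/y(λ))^m`; ★★★ `widthTwo_contacts_lower_chernoff`
— for `x² < λ < 1`: `P_k^{ab}(#top ≤ m) ≤ C·λ^k·(y₂/y(λ))^m` (here `P_k^{ab}` = the `wD 2 y₂`-mass of the event among the bridges `a → b` of hat index `k`,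
divided by `D̂(k; y₂)_{ab}`).
§6 `yOneDerivTwo`, `hasDerivAt_yOfLam_one`, ★ `yOneDerivTwo_div_stripYT_two` (`y'(1)/y₂ = 2/(1 + 2x²) = 1/(2θ₂)`: the log-derivative of the
parametrisation at criticality is the reciprocal contact rate), `thetaTwo_eq_xc`, ★ `exists_tilt_above` / `exists_tilt_below` (for `θ' > θ₂`, resp.
`0 < θ' < θ₂`, a tilt with `λ·(y₂/y(λ))^{2θ'} < 1` — first-order comparison of `log y(λ)` and `log λ/(2θ')` at `λ = 1` via `slope`), and
★★★ **`widthTwo_contacts_density_upper_exponential` / `widthTwo_contacts_density_lower_exponential`** — for every `θ' > θ₂` (resp. `0 < θ' < θ₂`)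
and all `a, b` there are `C` and `ρ < 1` with, eventually in `k`, `P_k^{ab}(#top ≥ θ'·n_k) ≤ C·ρ^k` (resp. `P_k^{ab}(#top ≤ θ'·n_k) ≤ C·ρ^k`):
EXPONENTIAL concentration of the contact density (the `1/n` rate of «CHEBYSHEV RATE» upgraded to a large-deviation upper bound).

Label: LANE THEOREM (own result of lane «pcv-sawmu», a-p2 g27, 2026-08-28; not in print).  NOT claimed: the rate function (the optimal `ρ(θ')`, a
Legendre transform of `log λ`), a lower large-deviation bound, a CLT — for which the parametrisation `y(λ)` is the intended first brick (the Perron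
root is then smooth in the tilt without an implicit-function argument).
-/

noncomputable section

open Finset Filter Topology Matrix Literature.Probability.LatticeModels Literature.Probability.Percolation Literature.Analysis

namespace Literature.Probability.RandomPlanarGeometry.SAW

namespace HV

namespace W2

/-! ## §1 The Perron parametrisation `y(λ)` of the tilted transfer matrix `G(y)` -/

/-- The Perron cubic of `G(y)`: `c(y, λ) = λ³ − x²(1+y)λ² + x⁴yλ − x⁶y` (`charpoly G(y) = λ·c(y, λ)`, «WIDTH-TWO HAT RECURSION» `gTwo_cayleyHamilton`).
[cite: Stanley2012EC1, §4.1 Theorem 4.1.1; lane «pcv-sawmu» a-p2 g27] -/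
def perronCubicTwo (y lam : ℝ) : ℝ :=
  lam ^ 3 - hexCriticalFugacity ^ 2 * (1 + y) * lam ^ 2 + hexCriticalFugacity ^ 4 * y * lam - hexCriticalFugacity ^ 6 * y

/-- ★ **The Perron parametrisation**: `y(λ) = λ²(λ − x²)/(x²(λ² − x²λ + x⁴))` — the unique fugacity at which `λ` is a root of the Perron cubic
(`c` is LINEAR in `y`), so the tilt `y` and the Perron root `λ` determine each other explicitly, without Cardano or an implicit function.
[cite: Seneta1973, §1.4; lane «pcv-sawmu» a-p2 g27 — own] -/
def yOfLam (lam : ℝ) : ℝ :=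
  lam ^ 2 * (lam - hexCriticalFugacity ^ 2) / (hexCriticalFugacity ^ 2 * (lam ^ 2 - hexCriticalFugacity ^ 2 * lam + hexCriticalFugacity ^ 4))

/-- `λ² − x²λ + x⁴ > 0` (negative discriminant). [cite: Seneta1973, §1.4; lane plumbing] -/
theorem lamQuad_pos (lam : ℝ) : 0 < lam ^ 2 - hexCriticalFugacity ^ 2 * lam + hexCriticalFugacity ^ 4 := by
  have hx : 0 < hexCriticalFugacity := hexCriticalFugacity_pos_lt_one.1
  have hx4 : 0 < hexCriticalFugacity ^ 4 := by positivity
  nlinarith [sq_nonneg (lam - hexCriticalFugacity ^ 2 / 2)]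

/-- `c(y(λ), λ) = 0` for every `λ`. [cite: Seneta1973, §1.4; lane «pcv-sawmu» a-p2 g27] -/
theorem perronCubicTwo_yOfLam (lam : ℝ) : perronCubicTwo (yOfLam lam) lam = 0 := by
  have hq := (lamQuad_pos lam).ne'
  have hx : (hexCriticalFugacity ^ 2) ≠ 0 := by have := hexCriticalFugacity_pos_lt_one.1; positivity
  have key : yOfLam lam * (hexCriticalFugacity ^ 2 * (lam ^ 2 - hexCriticalFugacity ^ 2 * lam + hexCriticalFugacity ^ 4))
      = lam ^ 2 * (lam - hexCriticalFugacity ^ 2) := by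
    rw [yOfLam]; exact div_mul_cancel₀ _ (mul_ne_zero hx hq)
  have e : perronCubicTwo (yOfLam lam) lam = lam ^ 3 - hexCriticalFugacity ^ 2 * lam ^ 2
      - yOfLam lam * (hexCriticalFugacity ^ 2 * (lam ^ 2 - hexCriticalFugacity ^ 2 * lam + hexCriticalFugacity ^ 4)) := by
    rw [perronCubicTwo]; ring
  rw [e, key]
  ring

/-- `y(λ) > 0` for `λ > x²`. [cite: Seneta1973, §1.4; lane plumbing] -/
theorem yOfLam_pos {lam : ℝ} (hlam : hexCriticalFugacity ^ 2 < lam) : 0 < yOfLam lam := by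
  have hx : 0 < hexCriticalFugacity := hexCriticalFugacity_pos_lt_one.1
  have h1 : 0 < lam := lt_trans (by positivity) hlam
  rw [yOfLam]
  exact div_pos (mul_pos (by positivity) (by linarith)) (mul_pos (by positivity) (lamQuad_pos lam))

/-- ★ `y(1) = y₂`: the untilted point of the parametrisation is the critical surface fugacity (`7y₂ = 26 − 16x²`, `2x⁴ − 4x² + 1 = 0`).
[cite: BeatonBousquetMelouDeGierDuminilCopinGuttmann2014, Corollary 8 (the threshold y_T); lane «pcv-sawmu» a-p2 g27] -/
theorem yOfLam_one : yOfLam 1 = stripYT 2 := by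
  have hP := xc_minpoly
  have hy := seven_mul_stripYT_two
  have hx : 0 < hexCriticalFugacity := hexCriticalFugacity_pos_lt_one.1
  have hq := lamQuad_pos 1
  set x := hexCriticalFugacity with hx'
  set y := stripYT 2 with hydef
  rw [yOfLam, ← hx', div_eq_iff (mul_pos (by positivity) hq).ne']
  linear_combination ((1 : ℝ) + (-5/7 : ℝ) * x ^ 2 + (8/7 : ℝ) * x ^ 4) * hP + ((-1/7 : ℝ) * x ^ 2 + (1/7 : ℝ) * x ^ 4 + (-1/7 : ℝ) * x ^ 6) * hy

/-- The monotonicity polynomial `Q(λ) = (1 − x² + x⁴)λ² − x²(1 − x²)²λ + x⁴(1 − x²)`, positive for every real `λ` (negative discriminant).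
[cite: Seneta1973, §1.4; lane plumbing] -/
theorem monoPoly_pos (lam : ℝ) :
    0 < (1 - hexCriticalFugacity ^ 2 + hexCriticalFugacity ^ 4) * lam ^ 2 - hexCriticalFugacity ^ 2 * (1 - hexCriticalFugacity ^ 2) ^ 2 * lam
      + hexCriticalFugacity ^ 4 * (1 - hexCriticalFugacity ^ 2) := by
  obtain ⟨h1, h2⟩ := xc_sq_bounds
  set s := hexCriticalFugacity ^ 2 with hs
  have e4 : hexCriticalFugacity ^ 4 = s ^ 2 := by rw [hs]; ring
  rw [e4]
  have hA : 0 < 1 - s + s ^ 2 := by nlinarith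
  have hdisc : 0 < 4 * (1 - s + s ^ 2) * (s ^ 2 * (1 - s)) - (s * (1 - s) ^ 2) ^ 2 := by nlinarith [mul_pos (mul_pos (by positivity : (0:ℝ) < s ^ 2) (by linarith : (0:ℝ) < 1 - s)) (by nlinarith : (0:ℝ) < 4 * (1 - s + s ^ 2) - (1 - s) ^ 3)]
  have key : 4 * (1 - s + s ^ 2) * ((1 - s + s ^ 2) * lam ^ 2 - s * (1 - s) ^ 2 * lam + s ^ 2 * (1 - s))
      = (2 * (1 - s + s ^ 2) * lam - s * (1 - s) ^ 2) ^ 2 + (4 * (1 - s + s ^ 2) * (s ^ 2 * (1 - s)) - (s * (1 - s) ^ 2) ^ 2) := by ring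
  nlinarith [sq_nonneg (2 * (1 - s + s ^ 2) * lam - s * (1 - s) ^ 2)]

/-- ★ `y(λ) − y₂ = (λ − 1)·Q(λ)/(x²(λ² − x²λ + x⁴)(1 − x² + x⁴))`: the parametrisation is increasing through the critical point.
[cite: Seneta1973, §1.4; lane «pcv-sawmu» a-p2 g27] -/
theorem yOfLam_sub_stripYT_two (lam : ℝ) :
    yOfLam lam - stripYT 2 = (lam - 1) * ((1 - hexCriticalFugacity ^ 2 + hexCriticalFugacity ^ 4) * lam ^ 2
      - hexCriticalFugacity ^ 2 * (1 - hexCriticalFugacity ^ 2) ^ 2 * lam + hexCriticalFugacity ^ 4 * (1 - hexCriticalFugacity ^ 2))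
      / (hexCriticalFugacity ^ 2 * (lam ^ 2 - hexCriticalFugacity ^ 2 * lam + hexCriticalFugacity ^ 4) * (1 - hexCriticalFugacity ^ 2 + hexCriticalFugacity ^ 4)) := by
  rw [← yOfLam_one, yOfLam, yOfLam]
  have hx : 0 < hexCriticalFugacity := hexCriticalFugacity_pos_lt_one.1
  have hx2 : hexCriticalFugacity ^ 2 ≠ 0 := by positivity
  have hq := (lamQuad_pos lam).ne'
  have hq1 : (1 : ℝ) ^ 2 - hexCriticalFugacity ^ 2 * 1 + hexCriticalFugacity ^ 4 ≠ 0 := (lamQuad_pos 1).ne'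
  have hA : (1 - hexCriticalFugacity ^ 2 + hexCriticalFugacity ^ 4) ≠ 0 := by nlinarith [xc_sq_bounds.1, xc_sq_bounds.2]
  rw [div_sub_div _ _ (mul_ne_zero hx2 hq) (mul_ne_zero hx2 hq1), div_eq_div_iff (mul_ne_zero (mul_ne_zero hx2 hq) (mul_ne_zero hx2 hq1))
    (mul_ne_zero (mul_ne_zero hx2 hq) hA)]
  ring

/-- `y(λ) > y₂` for `λ > 1` and `0 < y(λ) < y₂` for `x² < λ < 1`. [cite: Seneta1973, §1.4; lane «pcv-sawmu» a-p2 g27] -/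
theorem yOfLam_facts :
    (∀ lam : ℝ, 1 < lam → stripYT 2 < yOfLam lam) ∧ (∀ lam : ℝ, hexCriticalFugacity ^ 2 < lam → lam < 1 → 0 < yOfLam lam ∧ yOfLam lam < stripYT 2) := by
  have hx : 0 < hexCriticalFugacity := hexCriticalFugacity_pos_lt_one.1
  have hA : 0 < 1 - hexCriticalFugacity ^ 2 + hexCriticalFugacity ^ 4 := by nlinarith [xc_sq_bounds.1, xc_sq_bounds.2]
  have hden : ∀ lam : ℝ, 0 < hexCriticalFugacity ^ 2 * (lam ^ 2 - hexCriticalFugacity ^ 2 * lam + hexCriticalFugacity ^ 4)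
      * (1 - hexCriticalFugacity ^ 2 + hexCriticalFugacity ^ 4) := fun lam => mul_pos (mul_pos (by positivity) (lamQuad_pos lam)) hA
  refine ⟨fun lam hlam => ?_, fun lam h0 h1 => ⟨yOfLam_pos h0, ?_⟩⟩
  · have h := yOfLam_sub_stripYT_two lam
    have : 0 < yOfLam lam - stripYT 2 := by
      rw [h]; exact div_pos (mul_pos (by linarith) (monoPoly_pos lam)) (hden lam)
    linarith
  · have h := yOfLam_sub_stripYT_two lam
    have : yOfLam lam - stripYT 2 < 0 := by
      rw [h]; exact div_neg_of_neg_of_pos (mul_neg_of_neg_of_pos (by linarith) (monoPoly_pos lam)) (hden lam)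
    linarith

/-! ## §2 The positive eigenvector of `G(y)` for the eigenvalue `λ` (when `c(y, λ) = 0`) -/

/-- ★ The explicit right eigenvector `u(y, λ) = (x³y, x⁴y, xy(λ − x²), λ(λ − x²))` of `G(y)`. [cite: Seneta1973, §1.4; lane «pcv-sawmu» a-p2 g27 — own] -/
def uLam (y lam : ℝ) : Fin (2 * 2) → ℝ :=
  ![hexCriticalFugacity ^ 3 * y, hexCriticalFugacity ^ 4 * y, hexCriticalFugacity * y * (lam - hexCriticalFugacity ^ 2),
    lam * (lam - hexCriticalFugacity ^ 2)]

/-- ★ `G(y)·u(y, λ) = λ·u(y, λ)` whenever `c(y, λ) = 0` (rows `0–2` identically, row `3` is the cubic). [cite: Seneta1973, §1.4; lane «pcv-sawmu» a-p2 g27 — own] -/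
theorem gTwo_mulVec_uLam {y lam : ℝ} (hc : perronCubicTwo y lam = 0) : gTwo y *ᵥ uLam y lam = lam • uLam y lam := by
  rw [perronCubicTwo] at hc
  ext a
  fin_cases a <;> simp [gTwo, uLam, Matrix.mulVec, dotProduct, Fin.sum_univ_four] <;> first | linear_combination (-1 : ℝ) * hc | ring

/-- `u(y, λ) > 0` entrywise for `y > 0`, `λ > x²`. [cite: Seneta1973, §1.4; lane plumbing] -/
theorem uLam_pos {y lam : ℝ} (hy : 0 < y) (hlam : hexCriticalFugacity ^ 2 < lam) (a : Fin (2 * 2)) : 0 < uLam y lam a := by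
  have hx : 0 < hexCriticalFugacity := hexCriticalFugacity_pos_lt_one.1
  have h1 : 0 < lam := lt_trans (by positivity) hlam
  have h2 : 0 < lam - hexCriticalFugacity ^ 2 := by linarith
  fin_cases a <;> simp [uLam] <;> positivity

/-- `G(y)^k·u = λ^k·u`. [cite: Seneta1973, §1.4; lane plumbing] -/
theorem gTwo_pow_mulVec_uLam {y lam : ℝ} (hc : perronCubicTwo y lam = 0) (k : ℕ) : gTwo y ^ k *ᵥ uLam y lam = lam ^ k • uLam y lam := by
  induction k with
  | zero => simp
  | succ k ih => rw [pow_succ, ← Matrix.mulVec_mulVec, gTwo_mulVec_uLam hc, Matrix.mulVec_smul, ih, smul_smul, ← pow_succ']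

/-- The entries of `G(y)` are nonnegative for `y ≥ 0`, hence so are those of its powers. [cite: Seneta1973, §1.1; lane plumbing] -/
theorem gTwo_pow_apply_nonneg {y : ℝ} (hy : 0 ≤ y) (k : ℕ) (a c : Fin (2 * 2)) : 0 ≤ (gTwo y ^ k) a c := by
  have hx : 0 ≤ hexCriticalFugacity := hexCriticalFugacity_pos_lt_one.1.le
  have hG : ∀ i j, 0 ≤ gTwo y i j := fun i j => by
    fin_cases i <;> fin_cases j <;> simp [gTwo] <;> positivity
  induction k generalizing a c with
  | zero => rw [pow_zero, Matrix.one_apply]; split_ifs <;> norm_num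
  | succ k ih =>
    rw [pow_succ, Matrix.mul_apply]
    exact Finset.sum_nonneg fun j _ => mul_nonneg (ih a j) (hG j c)

/-- ★ **The Perron bound on the powers**: `(G(y)^k)_{ac}·u_c ≤ λ^k·u_a` (one nonnegative term of `(G^k u)_a = λ^k u_a`). [cite: Seneta1973, §1.1 (subinvariance); lane «pcv-sawmu» a-p2 g27] -/
theorem gTwo_pow_apply_mul_uLam_le {y lam : ℝ} (hy : 0 < y) (hlam : hexCriticalFugacity ^ 2 < lam) (hc : perronCubicTwo y lam = 0) (k : ℕ)
    (a c : Fin (2 * 2)) : (gTwo y ^ k) a c * uLam y lam c ≤ lam ^ k * uLam y lam a := by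
  have h := congrFun (gTwo_pow_mulVec_uLam hc k) a
  simp only [Matrix.mulVec, dotProduct, Pi.smul_apply, smul_eq_mul] at h
  rw [← h]
  exact Finset.single_le_sum (f := fun j => (gTwo y ^ k) a j * uLam y lam j)
    (fun j _ => mul_nonneg (gTwo_pow_apply_nonneg hy.le k a j) (uLam_pos hy hlam j).le) (Finset.mem_univ c)

/-! ## §3 The tilted hat bridge sums are at most `const·λ^k` -/

/-- The tilt constant `T_{ab}(y, λ) = u_a · Σ_c P_{cb}/u_c` (`P = 1 + M̂(0)`). [cite: Seneta1973, §1.1; lane «pcv-sawmu» a-p2 g27] -/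
def tiltConstTwo (y lam : ℝ) (a b : Fin (2 * 2)) : ℝ :=
  uLam y lam a * ∑ c : Fin (2 * 2), (1 + hatMZeroTwo) c b / uLam y lam c

/-- ★ **`D̂(k; y)_{ab} ≤ T_{ab}(y, λ)·λ^k`** for `k ≥ 1`, `y > 0`, `λ > x²` with `c(y, λ) = 0` — the hat bridge sums at a tilted fugacity grow at most like
the `k`-th power of the Perron root. [cite: Seneta1973, §1.1; Feller1968, XIII.10; lane «pcv-sawmu» a-p2 g27 — own] -/
theorem hatD_two_le_tilt {y lam : ℝ} (hy : 0 < y) (hlam : hexCriticalFugacity ^ 2 < lam) (hc : perronCubicTwo y lam = 0) {k : ℕ} (hk : 1 ≤ k)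
    (a b : Fin (2 * 2)) : hatD 2 y k a b ≤ tiltConstTwo y lam a b * lam ^ k := by
  have hx : 0 ≤ hexCriticalFugacity := hexCriticalFugacity_pos_lt_one.1.le
  have hP : ∀ c d : Fin (2 * 2), 0 ≤ (1 + hatMZeroTwo) c d := fun c d => by
    fin_cases c <;> fin_cases d <;> simp [hatMZeroTwo, Matrix.add_apply] <;> positivity
  rw [hatD_two_eq_pow_mul hy.le hk, Matrix.mul_apply, tiltConstTwo, Finset.mul_sum, Finset.sum_mul]
  refine Finset.sum_le_sum fun c _ => ?_
  have hu := uLam_pos hy hlam c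
  have h := gTwo_pow_apply_mul_uLam_le hy hlam hc k a c
  -- (G^k)_{ac} P_{cb} ≤ (λ^k u_a/u_c) P_{cb}
  have h' : (gTwo y ^ k) a c ≤ lam ^ k * uLam y lam a / uLam y lam c := by
    rw [le_div_iff₀ hu]; exact h
  calc (gTwo y ^ k) a c * (1 + hatMZeroTwo) c b ≤ lam ^ k * uLam y lam a / uLam y lam c * (1 + hatMZeroTwo) c b :=
        mul_le_mul_of_nonneg_right h' (hP c b)
    _ = uLam y lam a * ((1 + hatMZeroTwo) c b / uLam y lam c) * lam ^ k := by
        field_simp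

/-! ## §4 Exponential tilting of the contact weight -/

/-- ★ **Upper tilt**: for `y ≥ y₂` and any finite set of bridges, the `y₂`-mass of `{#top ≥ m}` is at most `(y₂/y)^m` times the total `y`-mass
(`wD 2 y l = x^{|l|−1} y^{#top}`). [cite: Feller1968, XIII.6; DuminilCopinHammond2013, §2.2 (the weights); lane «pcv-sawmu» a-p2 g27] -/
theorem sum_filter_ge_wD_le_tilt {y : ℝ} (hy : stripYT 2 ≤ y) (S : Finset (List HV)) (m : ℕ) :
    ∑ l ∈ S.filter (fun l => m ≤ topCnt 2 l.tail), wD 2 (stripYT 2) l ≤ (stripYT 2 / y) ^ m * ∑ l ∈ S, wD 2 y l := by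
  have hy2 : 0 < stripYT 2 := stripYT_pos (by norm_num)
  have hy0 : 0 < y := lt_of_lt_of_le hy2 hy
  have hx : 0 ≤ hexCriticalFugacity := hexCriticalFugacity_pos_lt_one.1.le
  have hr0 : 0 ≤ stripYT 2 / y := by positivity
  have hr1 : stripYT 2 / y ≤ 1 := (div_le_one hy0).2 hy
  rw [Finset.mul_sum]
  calc ∑ l ∈ S.filter (fun l => m ≤ topCnt 2 l.tail), wD 2 (stripYT 2) l
      ≤ ∑ l ∈ S.filter (fun l => m ≤ topCnt 2 l.tail), (stripYT 2 / y) ^ m * wD 2 y l := by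
        refine Finset.sum_le_sum fun l hl => ?_
        rw [Finset.mem_filter] at hl
        rw [wD, wD]
        have e : stripYT 2 ^ topCnt 2 l.tail = (stripYT 2 / y) ^ topCnt 2 l.tail * y ^ topCnt 2 l.tail := by
          rw [div_pow, div_mul_cancel₀ _ (pow_ne_zero _ hy0.ne')]
        rw [e]
        have h1 : (stripYT 2 / y) ^ topCnt 2 l.tail ≤ (stripYT 2 / y) ^ m := pow_le_pow_of_le_one hr0 hr1 hl.2
        have h2 : 0 ≤ hexCriticalFugacity ^ (l.length - 1) * y ^ topCnt 2 l.tail := by positivity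
        calc hexCriticalFugacity ^ (l.length - 1) * ((stripYT 2 / y) ^ topCnt 2 l.tail * y ^ topCnt 2 l.tail)
            = (stripYT 2 / y) ^ topCnt 2 l.tail * (hexCriticalFugacity ^ (l.length - 1) * y ^ topCnt 2 l.tail) := by ring
          _ ≤ (stripYT 2 / y) ^ m * (hexCriticalFugacity ^ (l.length - 1) * y ^ topCnt 2 l.tail) := mul_le_mul_of_nonneg_right h1 h2
    _ ≤ ∑ l ∈ S, (stripYT 2 / y) ^ m * wD 2 y l :=
        Finset.sum_le_sum_of_subset_of_nonneg (Finset.filter_subset _ _) fun l _ _ => mul_nonneg (pow_nonneg hr0 m) (wD_nonneg 2 hy0.le l)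

/-- ★ **Lower tilt**: for `0 < y ≤ y₂`, the `y₂`-mass of `{#top ≤ m}` is at most `(y₂/y)^m` times the total `y`-mass.
[cite: Feller1968, XIII.6; DuminilCopinHammond2013, §2.2; lane «pcv-sawmu» a-p2 g27] -/
theorem sum_filter_le_wD_le_tilt {y : ℝ} (hy0 : 0 < y) (hy : y ≤ stripYT 2) (S : Finset (List HV)) (m : ℕ) :
    ∑ l ∈ S.filter (fun l => topCnt 2 l.tail ≤ m), wD 2 (stripYT 2) l ≤ (stripYT 2 / y) ^ m * ∑ l ∈ S, wD 2 y l := by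
  have hx : 0 ≤ hexCriticalFugacity := hexCriticalFugacity_pos_lt_one.1.le
  have hr1 : 1 ≤ stripYT 2 / y := (one_le_div hy0).2 hy
  have hr0 : 0 ≤ stripYT 2 / y := le_trans zero_le_one hr1
  rw [Finset.mul_sum]
  calc ∑ l ∈ S.filter (fun l => topCnt 2 l.tail ≤ m), wD 2 (stripYT 2) l
      ≤ ∑ l ∈ S.filter (fun l => topCnt 2 l.tail ≤ m), (stripYT 2 / y) ^ m * wD 2 y l := by
        refine Finset.sum_le_sum fun l hl => ?_
        rw [Finset.mem_filter] at hl
        rw [wD, wD]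
        have e : stripYT 2 ^ topCnt 2 l.tail = (stripYT 2 / y) ^ topCnt 2 l.tail * y ^ topCnt 2 l.tail := by
          rw [div_pow, div_mul_cancel₀ _ (pow_ne_zero _ hy0.ne')]
        rw [e]
        have h1 : (stripYT 2 / y) ^ topCnt 2 l.tail ≤ (stripYT 2 / y) ^ m := pow_le_pow_right₀ hr1 hl.2
        have h2 : 0 ≤ hexCriticalFugacity ^ (l.length - 1) * y ^ topCnt 2 l.tail := by positivity
        calc hexCriticalFugacity ^ (l.length - 1) * ((stripYT 2 / y) ^ topCnt 2 l.tail * y ^ topCnt 2 l.tail)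
            = (stripYT 2 / y) ^ topCnt 2 l.tail * (hexCriticalFugacity ^ (l.length - 1) * y ^ topCnt 2 l.tail) := by ring
          _ ≤ (stripYT 2 / y) ^ m * (hexCriticalFugacity ^ (l.length - 1) * y ^ topCnt 2 l.tail) := mul_le_mul_of_nonneg_right h1 h2
    _ ≤ ∑ l ∈ S, (stripYT 2 / y) ^ m * wD 2 y l :=
        Finset.sum_le_sum_of_subset_of_nonneg (Finset.filter_subset _ _) fun l _ _ => mul_nonneg (pow_nonneg hr0 m) (wD_nonneg 2 hy0.le l)

/-- `D̂(k; y)_{ab}` is the total `y`-mass of the bridges `a → b` of hat index `k` (definitional). [cite: Feller1968, XIII.3; lane plumbing] -/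
theorem hatD_two_eq_sum_wD (y : ℝ) (k : ℕ) (a b : Fin (2 * 2)) :
    hatD 2 y k a b = ∑ l ∈ LUset 2 (2 * k + 1) (hatLen k a b) (a : ℕ) (b : ℕ), wD 2 y l := rfl

/-! ## §5 Chernoff bounds for the surface-contact count -/

/-- `D̂(k; y₂)_{ab} ≥ limTwo_{ab}/2 > 0` eventually. [cite: Feller1968, XIII.10; lane plumbing] -/
theorem eventually_half_limTwo_le_hatD (a b : Fin (2 * 2)) : ∀ᶠ k : ℕ in atTop, limTwo a b / 2 ≤ hatD 2 (stripYT 2) k a b :=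
  (tendsto_hatD_two a b).eventually (eventually_ge_nhds (by linarith [limTwo_pos a b]))

/-- ★★★ **UPPER CHERNOFF BOUND**: for every `λ > 1` and all end levels `a, b` there is `C` with, eventually in `k` and for EVERY threshold `m`,
`(Σ_{bridges a→b of hat index k, #top ≥ m} x_c^{n} y₂^{#top}) / D̂(k)_{ab} ≤ C·λ^k·(y₂/y(λ))^m` (`y(λ) > y₂` the tilted fugacity with Perron root `λ`):
the probability of at least `m` surface contacts decays exponentially as soon as `m·log(y(λ)/y₂) > k·log λ`.
[cite: Feller1968, XIII.6; Seneta1973, §1.1; DuminilCopinHammond2013, §2.2; lane «pcv-sawmu» a-p2 g27 — own result, not in print] -/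
theorem widthTwo_contacts_upper_chernoff (a b : Fin (2 * 2)) {lam : ℝ} (hlam : 1 < lam) :
    ∃ C : ℝ, ∀ᶠ k : ℕ in atTop, ∀ m : ℕ,
      (∑ l ∈ (LUset 2 (2 * k + 1) (hatLen k a b) (a : ℕ) (b : ℕ)).filter (fun l => m ≤ topCnt 2 l.tail), wD 2 (stripYT 2) l) /
        hatD 2 (stripYT 2) k a b ≤ C * lam ^ k * (stripYT 2 / yOfLam lam) ^ m := by
  have hx : 0 < hexCriticalFugacity := hexCriticalFugacity_pos_lt_one.1
  have hx1 : hexCriticalFugacity ^ 2 < 1 := by nlinarith [xc_sq_bounds.2]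
  have hlamx : hexCriticalFugacity ^ 2 < lam := by linarith
  have hy2 : 0 < stripYT 2 := stripYT_pos (by norm_num)
  have hylt : stripYT 2 < yOfLam lam := yOfLam_facts.1 lam hlam
  have hy : 0 < yOfLam lam := lt_trans hy2 hylt
  have hc := perronCubicTwo_yOfLam lam
  have hA := limTwo_pos a b
  set T : ℝ := tiltConstTwo (yOfLam lam) lam a b with hT
  refine ⟨T / (limTwo a b / 2), ?_⟩
  filter_upwards [eventually_half_limTwo_le_hatD a b, eventually_ge_atTop 1] with k hk hk1 m
  have hD : 0 < hatD 2 (stripYT 2) k a b := lt_of_lt_of_le (by linarith) hk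
  have htilt := sum_filter_ge_wD_le_tilt hylt.le (LUset 2 (2 * k + 1) (hatLen k a b) (a : ℕ) (b : ℕ)) m
  rw [← hatD_two_eq_sum_wD] at htilt
  have hbound := hatD_two_le_tilt hy hlamx hc hk1 a b
  rw [← hT] at hbound
  have hr : 0 ≤ (stripYT 2 / yOfLam lam) ^ m := by positivity
  have hT0 : 0 ≤ T * lam ^ k := le_trans (LMM_LUM_nonneg hy.le _ a b).2 hbound
  rw [div_le_iff₀ hD]
  calc ∑ l ∈ (LUset 2 (2 * k + 1) (hatLen k a b) (a : ℕ) (b : ℕ)).filter (fun l => m ≤ topCnt 2 l.tail), wD 2 (stripYT 2) l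
      ≤ (stripYT 2 / yOfLam lam) ^ m * hatD 2 (yOfLam lam) k a b := htilt
    _ ≤ (stripYT 2 / yOfLam lam) ^ m * (T * lam ^ k) := mul_le_mul_of_nonneg_left hbound hr
    _ = T / (limTwo a b / 2) * lam ^ k * (stripYT 2 / yOfLam lam) ^ m * (limTwo a b / 2) := by
        field_simp
    _ ≤ T / (limTwo a b / 2) * lam ^ k * (stripYT 2 / yOfLam lam) ^ m * hatD 2 (stripYT 2) k a b := by
        apply mul_le_mul_of_nonneg_left hk
        have : 0 ≤ T / (limTwo a b / 2) * lam ^ k := by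
          rw [div_mul_eq_mul_div]; exact div_nonneg hT0 (by linarith)
        positivity

/-- ★★★ **LOWER CHERNOFF BOUND**: for every `x² < λ < 1` and all `a, b` there is `C` with, eventually in `k` and for every `m`,
`(Σ_{bridges a→b of hat index k, #top ≤ m} x_c^{n} y₂^{#top}) / D̂(k)_{ab} ≤ C·λ^k·(y₂/y(λ))^m` (`0 < y(λ) < y₂`).
[cite: Feller1968, XIII.6; Seneta1973, §1.1; DuminilCopinHammond2013, §2.2; lane «pcv-sawmu» a-p2 g27 — own result, not in print] -/
theorem widthTwo_contacts_lower_chernoff (a b : Fin (2 * 2)) {lam : ℝ} (hlam0 : hexCriticalFugacity ^ 2 < lam) (hlam1 : lam < 1) :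
    ∃ C : ℝ, ∀ᶠ k : ℕ in atTop, ∀ m : ℕ,
      (∑ l ∈ (LUset 2 (2 * k + 1) (hatLen k a b) (a : ℕ) (b : ℕ)).filter (fun l => topCnt 2 l.tail ≤ m), wD 2 (stripYT 2) l) /
        hatD 2 (stripYT 2) k a b ≤ C * lam ^ k * (stripYT 2 / yOfLam lam) ^ m := by
  have hx : 0 < hexCriticalFugacity := hexCriticalFugacity_pos_lt_one.1
  have hy2 : 0 < stripYT 2 := stripYT_pos (by norm_num)
  obtain ⟨hy, hylt⟩ := yOfLam_facts.2 lam hlam0 hlam1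
  have hc := perronCubicTwo_yOfLam lam
  have hA := limTwo_pos a b
  have hlam : 0 < lam := lt_trans (by positivity) hlam0
  set T : ℝ := tiltConstTwo (yOfLam lam) lam a b with hT
  refine ⟨T / (limTwo a b / 2), ?_⟩
  filter_upwards [eventually_half_limTwo_le_hatD a b, eventually_ge_atTop 1] with k hk hk1 m
  have hD : 0 < hatD 2 (stripYT 2) k a b := lt_of_lt_of_le (by linarith) hk
  have htilt := sum_filter_le_wD_le_tilt hy hylt.le (LUset 2 (2 * k + 1) (hatLen k a b) (a : ℕ) (b : ℕ)) m
  rw [← hatD_two_eq_sum_wD] at htilt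
  have hbound := hatD_two_le_tilt hy hlam0 hc hk1 a b
  rw [← hT] at hbound
  have hr : 0 ≤ (stripYT 2 / yOfLam lam) ^ m := by positivity
  have hT0 : 0 ≤ T * lam ^ k := le_trans (LMM_LUM_nonneg hy.le _ a b).2 hbound
  rw [div_le_iff₀ hD]
  calc ∑ l ∈ (LUset 2 (2 * k + 1) (hatLen k a b) (a : ℕ) (b : ℕ)).filter (fun l => topCnt 2 l.tail ≤ m), wD 2 (stripYT 2) l
      ≤ (stripYT 2 / yOfLam lam) ^ m * hatD 2 (yOfLam lam) k a b := htilt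
    _ ≤ (stripYT 2 / yOfLam lam) ^ m * (T * lam ^ k) := mul_le_mul_of_nonneg_left hbound hr
    _ = T / (limTwo a b / 2) * lam ^ k * (stripYT 2 / yOfLam lam) ^ m * (limTwo a b / 2) := by
        field_simp
    _ ≤ T / (limTwo a b / 2) * lam ^ k * (stripYT 2 / yOfLam lam) ^ m * hatD 2 (stripYT 2) k a b := by
        apply mul_le_mul_of_nonneg_left hk
        have : 0 ≤ T / (limTwo a b / 2) * lam ^ k := by
          rw [div_mul_eq_mul_div]; exact div_nonneg hT0 (by linarith)
        positivity

/-! ## §6 Exponential concentration of the contact DENSITY around `θ₂ = (3 − √2)/4` -/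

/-- The derivative of the Perron parametrisation at the critical point `λ = 1` (closed form). [cite: Seneta1973, §1.4; lane plumbing] -/
def yOneDerivTwo : ℝ :=
  ((3 - 2 * hexCriticalFugacity ^ 2) * (hexCriticalFugacity ^ 2 * (1 - hexCriticalFugacity ^ 2 + hexCriticalFugacity ^ 4))
    - (1 - hexCriticalFugacity ^ 2) * (hexCriticalFugacity ^ 2 * (2 - hexCriticalFugacity ^ 2)))
    / (hexCriticalFugacity ^ 2 * (1 - hexCriticalFugacity ^ 2 + hexCriticalFugacity ^ 4)) ^ 2

/-- `y'(1) = yOneDerivTwo`. [cite: Seneta1973, §1.4; lane plumbing] -/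
theorem hasDerivAt_yOfLam_one : HasDerivAt yOfLam yOneDerivTwo 1 := by
  have hD1 : hexCriticalFugacity ^ 2 * ((1:ℝ) ^ 2 - hexCriticalFugacity ^ 2 * 1 + hexCriticalFugacity ^ 4) ≠ 0 :=
    mul_ne_zero (by have := hexCriticalFugacity_pos_lt_one.1; positivity) (lamQuad_pos 1).ne'
  have hf : HasDerivAt (fun lam : ℝ => lam ^ 2 * (lam - hexCriticalFugacity ^ 2))
      (((2 : ℕ) : ℝ) * (1:ℝ) ^ (2 - 1) * 1 * ((1:ℝ) - hexCriticalFugacity ^ 2) + (1:ℝ) ^ 2 * 1) 1 :=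
    ((hasDerivAt_id (1:ℝ)).pow 2).mul ((hasDerivAt_id (1:ℝ)).sub_const _)
  have hg : HasDerivAt (fun lam : ℝ => hexCriticalFugacity ^ 2 * (lam ^ 2 - hexCriticalFugacity ^ 2 * lam + hexCriticalFugacity ^ 4))
      (hexCriticalFugacity ^ 2 * (((2 : ℕ) : ℝ) * (1:ℝ) ^ (2 - 1) * 1 - hexCriticalFugacity ^ 2 * 1)) 1 :=
    ((((hasDerivAt_id (1:ℝ)).pow 2).sub ((hasDerivAt_id (1:ℝ)).const_mul _)).add_const _).const_mul _
  have h := hf.div hg hD1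
  refine h.congr_deriv ?_
  unfold yOneDerivTwo
  push_cast
  ring

/-- ★ **The logarithmic derivative of the parametrisation at criticality is the reciprocal mean contact rate**: `y'(1)/y₂ = 2/(1 + 2x²) = 1/φ₃ = (6 + 2√2)/7`
(`φ₃ = ½ + x² = 2θ₂`, «WIDTH-TWO CONTACT VARIANCE RATE» `phiTwo_three_eq`). [cite: Feller1968, XIII.6; lane «pcv-sawmu» a-p2 g27 — own computation] -/
theorem yOneDerivTwo_div_stripYT_two : yOneDerivTwo / stripYT 2 = 2 / (1 + 2 * hexCriticalFugacity ^ 2) := by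
  have hP := xc_minpoly
  have hy := seven_mul_stripYT_two
  have hx : 0 < hexCriticalFugacity := hexCriticalFugacity_pos_lt_one.1
  have hy2 : 0 < stripYT 2 := stripYT_pos (by norm_num)
  have hA : 0 < 1 - hexCriticalFugacity ^ 2 + hexCriticalFugacity ^ 4 := by nlinarith [xc_sq_bounds.1, xc_sq_bounds.2]
  have hD1sq : (hexCriticalFugacity ^ 2 * (1 - hexCriticalFugacity ^ 2 + hexCriticalFugacity ^ 4)) ^ 2 ≠ 0 := by positivity
  set x := hexCriticalFugacity with hx'
  set y := stripYT 2 with hydef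
  rw [div_eq_div_iff hy2.ne' (by positivity), yOneDerivTwo, div_mul_eq_mul_div, div_eq_iff hD1sq]
  linear_combination ((1 : ℝ) * x ^ 2 + (-24/7 : ℝ) * x ^ 4 + (26/7 : ℝ) * x ^ 6 + (-26/7 : ℝ) * x ^ 8 + (16/7 : ℝ) * x ^ 10) * hP
    + ((-2/7 : ℝ) * x ^ 4 + (4/7 : ℝ) * x ^ 6 + (-6/7 : ℝ) * x ^ 8 + (4/7 : ℝ) * x ^ 10 + (-2/7 : ℝ) * x ^ 12) * hy

/-- `θ₂ = (3 − √2)/4 = (1 + 2x²)/4`. [cite: BeatonBousquetMelouDeGierDuminilCopinGuttmann2014, Corollary 8; lane plumbing] -/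
theorem thetaTwo_eq_xc : (3 - Real.sqrt 2) / 4 = (1 + 2 * hexCriticalFugacity ^ 2) / 4 := by
  rw [sqrt_two_eq]; ring

/-- ★ **Existence of a good tilt above**: for every density `θ' > θ₂` there is `λ > 1` with `λ·(y₂/y(λ))^{2θ'} < 1` — the log-derivative of
`λ ↦ log y(λ) − log λ/(2θ')` at `1` is `1/φ₃ − 1/(2θ') > 0`. [cite: Feller1968, XIII.6; lane «pcv-sawmu» a-p2 g27 — own] -/
theorem exists_tilt_above {θ' : ℝ} (hθ : (3 - Real.sqrt 2) / 4 < θ') :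
    ∃ lam : ℝ, 1 < lam ∧ lam * (stripYT 2 / yOfLam lam) ^ (2 * θ') < 1 := by
  have hx : 0 < hexCriticalFugacity := hexCriticalFugacity_pos_lt_one.1
  have hy2 : 0 < stripYT 2 := stripYT_pos (by norm_num)
  rw [thetaTwo_eq_xc] at hθ
  have hθ0 : 0 < θ' := lt_trans (by positivity) hθ
  -- F(λ) = log y(λ) − log λ/(2θ')
  set F : ℝ → ℝ := fun lam => Real.log (yOfLam lam) - Real.log lam / (2 * θ') with hF
  have hx1 : hexCriticalFugacity ^ 2 < 1 := by nlinarith [xc_sq_bounds.2]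
  have hy1 : yOfLam 1 ≠ 0 := (yOfLam_pos (lam := 1) hx1).ne'
  have hF' : HasDerivAt F (yOneDerivTwo / yOfLam 1 - 1⁻¹ / (2 * θ')) 1 :=
    (hasDerivAt_yOfLam_one.log hy1).sub ((Real.hasDerivAt_log one_ne_zero).div_const _)
  have hpos : 0 < yOneDerivTwo / yOfLam 1 - 1⁻¹ / (2 * θ') := by
    rw [yOfLam_one, yOneDerivTwo_div_stripYT_two, inv_one]
    rw [div_sub_div _ _ (by positivity) (by positivity)]
    exact div_pos (by nlinarith) (by positivity)
  -- slope F 1 λ → F'(1) > 0 along λ → 1⁺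
  have hslope : Tendsto (slope F 1) (𝓝[>] 1) (𝓝 (yOneDerivTwo / yOfLam 1 - 1⁻¹ / (2 * θ'))) :=
    (hasDerivAt_iff_tendsto_slope.1 hF').mono_left (nhdsWithin_mono _ fun z hz => ne_of_gt hz)
  have hev : ∀ᶠ lam in 𝓝[>] (1 : ℝ), 0 < slope F 1 lam := hslope.eventually (eventually_gt_nhds hpos)
  obtain ⟨lam, hsl, hlam1⟩ := (hev.and self_mem_nhdsWithin).exists
  have hlam1' : (1 : ℝ) < lam := hlam1
  refine ⟨lam, hlam1', ?_⟩
  have hFlt : F 1 < F lam := by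
    rw [slope_def_field] at hsl
    have : 0 < F lam - F 1 := by
      have h := mul_pos hsl (sub_pos.2 hlam1')
      rwa [div_mul_cancel₀ _ (sub_pos.2 hlam1').ne'] at h
    linarith
  have hylam : 0 < yOfLam lam := yOfLam_pos (lt_trans hx1 hlam1')
  have hlam0 : 0 < lam := lt_trans one_pos hlam1'
  -- unpack: log y₂ < log y(λ) − log λ/(2θ')  ⇒  log(λ·(y₂/y(λ))^{2θ'}) < 0
  simp only [hF, yOfLam_one, Real.log_one, zero_div, sub_zero] at hFlt
  have hr : 0 < stripYT 2 / yOfLam lam := div_pos hy2 hylam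
  rw [← Real.log_neg_iff (by positivity), Real.log_mul hlam0.ne' (Real.rpow_pos_of_pos hr _).ne', Real.log_rpow hr,
    Real.log_div hy2.ne' hylam.ne']
  have h2θ : 0 < 2 * θ' := by positivity
  have := (div_lt_iff₀ h2θ).1 (show Real.log lam / (2 * θ') < Real.log (yOfLam lam) - Real.log (stripYT 2) by linarith)
  nlinarith

/-- ★ **Existence of a good tilt below**: for every density `0 < θ' < θ₂` there is `x² < λ < 1` with `λ·(y₂/y(λ))^{2θ'} < 1`.
[cite: Feller1968, XIII.6; lane «pcv-sawmu» a-p2 g27 — own] -/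
theorem exists_tilt_below {θ' : ℝ} (hθ0 : 0 < θ') (hθ : θ' < (3 - Real.sqrt 2) / 4) :
    ∃ lam : ℝ, hexCriticalFugacity ^ 2 < lam ∧ lam < 1 ∧ lam * (stripYT 2 / yOfLam lam) ^ (2 * θ') < 1 := by
  have hx : 0 < hexCriticalFugacity := hexCriticalFugacity_pos_lt_one.1
  have hy2 : 0 < stripYT 2 := stripYT_pos (by norm_num)
  rw [thetaTwo_eq_xc] at hθ
  set F : ℝ → ℝ := fun lam => Real.log (yOfLam lam) - Real.log lam / (2 * θ') with hF
  have hx1 : hexCriticalFugacity ^ 2 < 1 := by nlinarith [xc_sq_bounds.2]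
  have hy1 : yOfLam 1 ≠ 0 := (yOfLam_pos (lam := 1) hx1).ne'
  have hF' : HasDerivAt F (yOneDerivTwo / yOfLam 1 - 1⁻¹ / (2 * θ')) 1 :=
    (hasDerivAt_yOfLam_one.log hy1).sub ((Real.hasDerivAt_log one_ne_zero).div_const _)
  have hneg : yOneDerivTwo / yOfLam 1 - 1⁻¹ / (2 * θ') < 0 := by
    rw [yOfLam_one, yOneDerivTwo_div_stripYT_two, inv_one]
    rw [div_sub_div _ _ (by positivity) (by positivity)]
    exact div_neg_of_neg_of_pos (by nlinarith) (by positivity)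
  have hslope : Tendsto (slope F 1) (𝓝[<] 1) (𝓝 (yOneDerivTwo / yOfLam 1 - 1⁻¹ / (2 * θ'))) :=
    (hasDerivAt_iff_tendsto_slope.1 hF').mono_left (nhdsWithin_mono _ fun z hz => ne_of_lt hz)
  have hev : ∀ᶠ lam in 𝓝[<] (1 : ℝ), slope F 1 lam < 0 := hslope.eventually (eventually_lt_nhds hneg)
  -- also λ > x² near 1
  have hev2 : ∀ᶠ lam in 𝓝[<] (1 : ℝ), hexCriticalFugacity ^ 2 < lam :=
    mem_nhdsWithin_of_mem_nhds (eventually_gt_nhds hx1)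
  obtain ⟨lam, ⟨hsl, hlamx⟩, hlam1⟩ := ((hev.and hev2).and self_mem_nhdsWithin).exists
  have hlam1' : lam < (1 : ℝ) := hlam1
  refine ⟨lam, hlamx, hlam1', ?_⟩
  have hFlt : F 1 < F lam := by
    rw [slope_def_field] at hsl
    have : 0 < F lam - F 1 := by
      have h := mul_pos_of_neg_of_neg hsl (sub_neg.2 hlam1')
      rwa [div_mul_cancel₀ _ (sub_neg.2 hlam1').ne] at h
    linarith
  have hylam : 0 < yOfLam lam := yOfLam_pos hlamx
  have hlam0 : 0 < lam := lt_trans (by positivity) hlamx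
  simp only [hF, yOfLam_one, Real.log_one, zero_div, sub_zero] at hFlt
  have hr : 0 < stripYT 2 / yOfLam lam := div_pos hy2 hylam
  rw [← Real.log_neg_iff (by positivity), Real.log_mul hlam0.ne' (Real.rpow_pos_of_pos hr _).ne', Real.log_rpow hr,
    Real.log_div hy2.ne' hylam.ne']
  have h2θ : 0 < 2 * θ' := by positivity
  have := (div_lt_iff₀ h2θ).1 (show Real.log lam / (2 * θ') < Real.log (yOfLam lam) - Real.log (stripYT 2) by linarith)
  nlinarith

/-- ★★★ **EXPONENTIAL CONCENTRATION ABOVE**: for every density `θ' > θ₂ = (3 − √2)/4` and all end levels `a, b` there are `C` and `ρ < 1` with,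
eventually in the hat index `k` (`n_k = hatLen k a b` steps),
`(Σ_{bridges a→b with n_k steps, #top ≥ θ'·n_k} x_c^{n_k} y₂^{#top}) / D̂(k)_{ab} ≤ C·ρ^k` — the surface-contact DENSITY of a long critical width-two bridge
exceeds `θ'` only with exponentially small probability (Chernoff bound at the good tilt of `exists_tilt_above`; compare the `1/n` of «CHEBYSHEV RATE»).
[cite: Feller1968, XIII.6; Seneta1973, §1.1; DuminilCopinHammond2013, §2.2; lane «pcv-sawmu» a-p2 g27 — own result, not in print] -/
theorem widthTwo_contacts_density_upper_exponential (a b : Fin (2 * 2)) {θ' : ℝ} (hθ : (3 - Real.sqrt 2) / 4 < θ') :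
    ∃ C ρ : ℝ, ρ < 1 ∧ ∀ᶠ k : ℕ in atTop,
      (∑ l ∈ (LUset 2 (2 * k + 1) (hatLen k a b) (a : ℕ) (b : ℕ)).filter (fun l => θ' * ((hatLen k a b : ℤ) : ℝ) ≤ (topCnt 2 l.tail : ℝ)),
          wD 2 (stripYT 2) l) / hatD 2 (stripYT 2) k a b ≤ C * ρ ^ k := by
  have hy2 : 0 < stripYT 2 := stripYT_pos (by norm_num)
  obtain ⟨lam, hlam, hρ⟩ := exists_tilt_above hθ
  obtain ⟨C0, hC0⟩ := widthTwo_contacts_upper_chernoff a b hlam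
  have hylt : stripYT 2 < yOfLam lam := yOfLam_facts.1 lam hlam
  have hy : 0 < yOfLam lam := lt_trans hy2 hylt
  set r : ℝ := stripYT 2 / yOfLam lam with hr
  have hr0 : 0 < r := div_pos hy2 hy
  have hr1 : r ≤ 1 := (div_le_one hy).2 hylt.le
  set c : ℝ := ((lchi a : ℤ) : ℝ) - ((lchi b : ℤ) : ℝ) with hc
  have hlam0 : 0 < lam := lt_trans one_pos hlam
  refine ⟨C0 * r ^ (θ' * c), lam * r ^ (2 * θ'), hρ, ?_⟩
  filter_upwards [hC0] with k hk
  have hn : ((hatLen k a b : ℤ) : ℝ) = 2 * (k : ℝ) + c := by rw [hc, hatLen]; push_cast; ring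
  -- the event `θ' n ≤ #top` is `⌈θ' n⌉₊ ≤ #top`
  set m : ℕ := ⌈θ' * ((hatLen k a b : ℤ) : ℝ)⌉₊ with hm
  have hsub : (LUset 2 (2 * k + 1) (hatLen k a b) (a : ℕ) (b : ℕ)).filter (fun l => θ' * ((hatLen k a b : ℤ) : ℝ) ≤ (topCnt 2 l.tail : ℝ))
      ⊆ (LUset 2 (2 * k + 1) (hatLen k a b) (a : ℕ) (b : ℕ)).filter (fun l => m ≤ topCnt 2 l.tail) := by
    intro l hl
    rw [Finset.mem_filter] at hl ⊢
    exact ⟨hl.1, Nat.ceil_le.2 hl.2⟩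
  have hD0 : 0 ≤ hatD 2 (stripYT 2) k a b := (LMM_LUM_nonneg hy2.le _ a b).2
  have hC0nn : 0 ≤ C0 * lam ^ k := by
    have h0 : (0 : ℝ) ≤ (∑ l ∈ (LUset 2 (2 * k + 1) (hatLen k a b) (a : ℕ) (b : ℕ)).filter (fun l => 0 ≤ topCnt 2 l.tail),
        wD 2 (stripYT 2) l) / hatD 2 (stripYT 2) k a b :=
      div_nonneg (Finset.sum_nonneg fun l _ => wD_nonneg 2 hy2.le l) hD0
    have := h0.trans (hk 0)
    simpa using this
  calc (∑ l ∈ (LUset 2 (2 * k + 1) (hatLen k a b) (a : ℕ) (b : ℕ)).filter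
          (fun l => θ' * ((hatLen k a b : ℤ) : ℝ) ≤ (topCnt 2 l.tail : ℝ)), wD 2 (stripYT 2) l) / hatD 2 (stripYT 2) k a b
      ≤ (∑ l ∈ (LUset 2 (2 * k + 1) (hatLen k a b) (a : ℕ) (b : ℕ)).filter (fun l => m ≤ topCnt 2 l.tail), wD 2 (stripYT 2) l)
          / hatD 2 (stripYT 2) k a b :=
        div_le_div_of_nonneg_right (Finset.sum_le_sum_of_subset_of_nonneg hsub fun l _ _ => wD_nonneg 2 hy2.le l) hD0
    _ ≤ C0 * lam ^ k * r ^ m := hk m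
    _ = C0 * lam ^ k * r ^ (m : ℝ) := by rw [Real.rpow_natCast]
    _ ≤ C0 * lam ^ k * r ^ (θ' * ((hatLen k a b : ℤ) : ℝ)) :=
        mul_le_mul_of_nonneg_left (Real.rpow_le_rpow_of_exponent_ge hr0 hr1 (Nat.le_ceil _)) hC0nn
    _ = C0 * r ^ (θ' * c) * (lam * r ^ (2 * θ')) ^ k := by
        rw [hn, show θ' * (2 * (k : ℝ) + c) = (2 * θ') * (k : ℝ) + θ' * c by ring, Real.rpow_add hr0, Real.rpow_mul hr0.le,
          Real.rpow_natCast, mul_pow]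
        ring

/-- ★★★ **EXPONENTIAL CONCENTRATION BELOW**: for every density `0 < θ' < θ₂` and all `a, b` there are `C` and `ρ < 1` with, eventually in `k`,
`(Σ_{bridges a→b with n_k steps, #top ≤ θ'·n_k} x_c^{n_k} y₂^{#top}) / D̂(k)_{ab} ≤ C·ρ^k`.
[cite: Feller1968, XIII.6; Seneta1973, §1.1; DuminilCopinHammond2013, §2.2; lane «pcv-sawmu» a-p2 g27 — own result, not in print] -/
theorem widthTwo_contacts_density_lower_exponential (a b : Fin (2 * 2)) {θ' : ℝ} (hθ0 : 0 < θ') (hθ : θ' < (3 - Real.sqrt 2) / 4) :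
    ∃ C ρ : ℝ, ρ < 1 ∧ ∀ᶠ k : ℕ in atTop,
      (∑ l ∈ (LUset 2 (2 * k + 1) (hatLen k a b) (a : ℕ) (b : ℕ)).filter (fun l => (topCnt 2 l.tail : ℝ) ≤ θ' * ((hatLen k a b : ℤ) : ℝ)),
          wD 2 (stripYT 2) l) / hatD 2 (stripYT 2) k a b ≤ C * ρ ^ k := by
  have hy2 : 0 < stripYT 2 := stripYT_pos (by norm_num)
  obtain ⟨lam, hlamx, hlam1, hρ⟩ := exists_tilt_below hθ0 hθ
  obtain ⟨C0, hC0⟩ := widthTwo_contacts_lower_chernoff a b hlamx hlam1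
  obtain ⟨hy, hylt⟩ := yOfLam_facts.2 lam hlamx hlam1
  set r : ℝ := stripYT 2 / yOfLam lam with hr
  have hr1 : 1 ≤ r := (one_le_div hy).2 hylt.le
  have hr0 : 0 < r := lt_of_lt_of_le one_pos hr1
  set c : ℝ := ((lchi a : ℤ) : ℝ) - ((lchi b : ℤ) : ℝ) with hc
  have hlam0 : 0 < lam := lt_trans (by have := hexCriticalFugacity_pos_lt_one.1; positivity) hlamx
  have hden : Tendsto (fun k : ℕ => ((hatLen k a b : ℤ) : ℝ)) atTop atTop := by
    have hL : (fun k : ℕ => ((hatLen k a b : ℤ) : ℝ)) = fun k : ℕ => 2 * (k : ℝ) + c := funext fun k => by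
      rw [hc, hatLen]; push_cast; ring
    rw [hL]
    exact (tendsto_natCast_atTop_atTop.const_mul_atTop two_pos).atTop_add tendsto_const_nhds
  refine ⟨C0 * r ^ (θ' * c), lam * r ^ (2 * θ'), hρ, ?_⟩
  filter_upwards [hC0, hden.eventually_ge_atTop 0] with k hk hn0
  have hn : ((hatLen k a b : ℤ) : ℝ) = 2 * (k : ℝ) + c := by rw [hc, hatLen]; push_cast; ring
  set m : ℕ := ⌊θ' * ((hatLen k a b : ℤ) : ℝ)⌋₊ with hm
  have hθn : 0 ≤ θ' * ((hatLen k a b : ℤ) : ℝ) := mul_nonneg hθ0.le hn0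
  have hsub : (LUset 2 (2 * k + 1) (hatLen k a b) (a : ℕ) (b : ℕ)).filter (fun l => (topCnt 2 l.tail : ℝ) ≤ θ' * ((hatLen k a b : ℤ) : ℝ))
      ⊆ (LUset 2 (2 * k + 1) (hatLen k a b) (a : ℕ) (b : ℕ)).filter (fun l => topCnt 2 l.tail ≤ m) := by
    intro l hl
    rw [Finset.mem_filter] at hl ⊢
    exact ⟨hl.1, Nat.le_floor hl.2⟩
  have hD0 : 0 ≤ hatD 2 (stripYT 2) k a b := (LMM_LUM_nonneg hy2.le _ a b).2
  have hC0nn : 0 ≤ C0 * lam ^ k := by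
    have h0 : (0 : ℝ) ≤ (∑ l ∈ (LUset 2 (2 * k + 1) (hatLen k a b) (a : ℕ) (b : ℕ)).filter (fun l => topCnt 2 l.tail ≤ 0),
        wD 2 (stripYT 2) l) / hatD 2 (stripYT 2) k a b :=
      div_nonneg (Finset.sum_nonneg fun l _ => wD_nonneg 2 hy2.le l) hD0
    have := h0.trans (hk 0)
    simpa using this
  calc (∑ l ∈ (LUset 2 (2 * k + 1) (hatLen k a b) (a : ℕ) (b : ℕ)).filter
          (fun l => (topCnt 2 l.tail : ℝ) ≤ θ' * ((hatLen k a b : ℤ) : ℝ)), wD 2 (stripYT 2) l) / hatD 2 (stripYT 2) k a b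
      ≤ (∑ l ∈ (LUset 2 (2 * k + 1) (hatLen k a b) (a : ℕ) (b : ℕ)).filter (fun l => topCnt 2 l.tail ≤ m), wD 2 (stripYT 2) l)
          / hatD 2 (stripYT 2) k a b :=
        div_le_div_of_nonneg_right (Finset.sum_le_sum_of_subset_of_nonneg hsub fun l _ _ => wD_nonneg 2 hy2.le l) hD0
    _ ≤ C0 * lam ^ k * r ^ m := hk m
    _ = C0 * lam ^ k * r ^ (m : ℝ) := by rw [Real.rpow_natCast]
    _ ≤ C0 * lam ^ k * r ^ (θ' * ((hatLen k a b : ℤ) : ℝ)) :=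
        mul_le_mul_of_nonneg_left (Real.rpow_le_rpow_of_exponent_le hr1 (Nat.floor_le hθn)) hC0nn
    _ = C0 * r ^ (θ' * c) * (lam * r ^ (2 * θ')) ^ k := by
        rw [hn, show θ' * (2 * (k : ℝ) + c) = (2 * θ') * (k : ℝ) + θ' * c by ring, Real.rpow_add hr0, Real.rpow_mul hr0.le,
          Real.rpow_natCast, mul_pow]
        ring

end W2

end HV

end Literature.Probability.RandomPlanarGeometry.SAW
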